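import Mathlib
import HarnessLib

/-!
# `NoHeavyLowerTail` (crux stmt-CriticalPhenomena-4575), antithetic vdBHK programme: explicit finite orbit posets for AK-ORBIT certificates

Support file (seat `prim-ineq-gen-7` gen 41; `--supports stmt-CriticalPhenomena-4575`).  No `sorry`.  Memo: FINDING-AKORB-g41.md §1, §6.

The orbits `O` of an AK-orbit certificate (memo §1) are small explicit posets: ι-closed subsets of a rest / fibre poset `F_v(T)` with the induced
order (a chain `{p < ιp}`, the bowtie `F_v(P₂)`, the fork poset, level cubes, products).  To instantiate
`AntitheticOrbitAssembly.orbit_kappa_sum_nonneg` on them, this file provides a uniform carrier: `Orb S` for an `OrbitSpec k` `S` = a Boolean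
order table on `Fin k` with its reflexivity / transitivity certificates (supplied by `decide` at each use), the `Preorder` and `Fintype`
instances, the sum expansion over `Fin k`, and table-defined self-maps (the involution `j`, the position maps `σ`).
-/

namespace Summit.CriticalPhenomena.PercolationContinuityZ3.Theorems

open Finset

namespace AntitheticOrbitPoset

/-- An explicit finite preorder on `Fin k`: a Boolean table with reflexivity and transitivity certificates. -/
structure OrbitSpec (k : ℕ) where
  /-- the order table: `rel a b = true` iff `a ≤ b` -/
  rel : Fin k → Fin k → Bool
  /-- reflexivity certificate -/
  refl : ∀ a, rel a a = true
  /-- transitivity certificate -/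
  trans : ∀ a b c, rel a b = true → rel b c = true → rel a c = true

/-- The carrier of the orbit poset described by `S` (a copy of `Fin k`). -/
structure Orb {k : ℕ} (S : OrbitSpec k) where
  /-- the index of the element -/
  i : Fin k
deriving DecidableEq

variable {k : ℕ} {S : OrbitSpec k}

/-- The preorder on `Orb S` read off the table. -/
instance : Preorder (Orb S) where
  le a b := S.rel a.i b.i = true
  le_refl a := S.refl a.i
  le_trans a b c hab hbc := S.trans a.i b.i c.i hab hbc

/-- The order on `Orb S` is decidable (it is a Boolean table). -/
instance (a b : Orb S) : Decidable (a ≤ b) := inferInstanceAs (Decidable (S.rel a.i b.i = true))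

/-- `Orb S` is `Fin k` in disguise. -/
def equivFin (S : OrbitSpec k) : Fin k ≃ Orb S where
  toFun i := ⟨i⟩
  invFun r := r.i
  left_inv _ := rfl
  right_inv _ := rfl

/-- `Orb S` is finite (a copy of `Fin k`). -/
instance : Fintype (Orb S) := Fintype.ofEquiv (Fin k) (equivFin S)

/-- The order on `Orb S` unfolds to the table. -/
theorem le_iff (a b : Orb S) : a ≤ b ↔ S.rel a.i b.i = true := Iff.rfl

/-- Sums over `Orb S` are sums over `Fin k`. -/
theorem sum_orb {M : Type*} [AddCommMonoid M] (f : Orb S → M) : ∑ r : Orb S, f r = ∑ i : Fin k, f ⟨i⟩ :=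
  (Equiv.sum_comp (equivFin S) f).symm

/-- A table-defined self-map of `Orb S`. -/
def tmap (t : Fin k → Fin k) : Orb S → Orb S := fun r => ⟨t r.i⟩

/-- Index of a table-mapped element. -/
@[simp] theorem tmap_i (t : Fin k → Fin k) (r : Orb S) : (tmap (S := S) t r).i = t r.i := rfl

/-- A table-defined involution of `Orb S` as an `Equiv`. -/
def tinv (t : Fin k → Fin k) (ht : ∀ i, t (t i) = i) : Orb S ≃ Orb S where
  toFun := tmap t
  invFun := tmap t
  left_inv r := by cases r; simp [tmap, ht]
  right_inv r := by cases r; simp [tmap, ht]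

/-- `tinv` unfolds to the table. -/
@[simp] theorem tinv_apply (t : Fin k → Fin k) (ht : ∀ i, t (t i) = i) (r : Orb S) : tinv (S := S) t ht r = ⟨t r.i⟩ := rfl

/-- `tinv` is an involution. -/
theorem tinv_tinv (t : Fin k → Fin k) (ht : ∀ i, t (t i) = i) (r : Orb S) : tinv (S := S) t ht (tinv t ht r) = r := by
  cases r; simp [ht]

/-- Comparability of every element with its partner, read off the tables. -/
theorem tinv_comparable (t : Fin k → Fin k) (ht : ∀ i, t (t i) = i)
    (hc : ∀ i, S.rel i (t i) = true ∨ S.rel (t i) i = true) (r : Orb S) : r ≤ tinv t ht r ∨ tinv t ht r ≤ r := by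
  cases r with
  | mk i => simpa [le_iff] using hc i

/-- Antitonicity of a table map, read off the tables. -/
theorem tmap_anti (t : Fin k → Fin k) (ha : ∀ a b, S.rel a b = true → S.rel (t b) (t a) = true) :
    ∀ r r' : Orb S, r ≤ r' → tmap (S := S) t r' ≤ tmap t r := by
  rintro ⟨a⟩ ⟨b⟩ h; exact ha a b h

/-- Monotonicity of a table-indexed family of finsets, read off the tables: if `F a ⊆ F b` whenever `rel a b`, then `r ↦ F r.i` is monotone. -/
theorem fam_mono {β : Type*} (F : Fin k → Finset β) (hF : ∀ a b, S.rel a b = true → F a ⊆ F b) :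
    ∀ r r' : Orb S, r ≤ r' → F r.i ⊆ F r'.i := by
  rintro ⟨a⟩ ⟨b⟩ h; exact hF a b h

end AntitheticOrbitPoset

end Summit.CriticalPhenomena.PercolationContinuityZ3.Theorems
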